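import Summits.QuantumFields.BalabanUV.T4Continuum.Support.NE7MinActC2AllDataUniform
import Summits.QuantumFields.BalabanUV.T4Continuum.Support.NE7SecondVariationHess
import HarnessLib

/-!
# NE7MinActHessianUniform — THE BORDERED HESSIAN OF THE CONSTRAINED MINIMAL ACTION AT EVERY SMALL DATUM WITH A LEVEL-UNIFORM DATUM RADIUS: `∃ ε₀ ∀ ε ∀ N ∃ δV ∀ j` instead of `∀ N ∀ j ∃ δV`
# (lineage `b2b-balaban-t4-ne7-p1`, gen 119, file U1: the first link of the (G′) chain re-issued in row NE7b's uniform-radius frame)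

Cell `pub-balaban`, rung (B)+1 sub-cell t4, CRUX PROVER NE7 #1 (OWNER of row NE7), generation 119.
WHY.  ✓ H15 `NE7EffectiveFormLowerBound.effectiveForm_lower_bound` — (G′) in kernel — inherits from ✓ `NE7MinActHessianLagrangianAllData.minAct_hessian_lagrangian_allData` (gen 115) the frame
`∀ N ∀ j ∃ δV`: its constants are level-uniform but the admissible radius of the datum `V₀` may shrink with the level `j`.  The ONLY j-dependent input of that theorem was the stabiliser
lifting `NE7StabiliserLifting.stabiliser_lifting` (`∀ N ∀ k ∃ δV`); row NE7b has since landed the uniform version ✓ `NE7StabiliserLiftingUniform.stabiliser_lifting_uniform` (`∀ N ∃ δV ∀ k`),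
and row NE7b re-assembled the Lagrangian-currency bordered Hessian in the uniform frame ✓ `NE7MinActC2AllDataUniform.minAct_hessian_lagrangian_allData_uniform`.  THIS FILE reads it in
`hess` currency (`NE7SecondVariationHess.second_variation`), the form G12∕H11 consume; files U2–U4 carry the uniformity through the slice attainment (G12), the socket (H11) and (G′) (H15–H18).
WHAT ([folklore]; 0 def, 0 sorry; d = 4; proof = gen 115's `NE7MinActHessianHessForm` with the quantifiers reordered): **`minAct_hessian_hessForm_allData_uniform`**.
HONEST FRAMING (page 1): calculus∕bookkeeping about OUR constrained minimal action; nothing of Bałaban's asserted; NOT NE7 as a spine node; spine 0∕9; finite T⁴ rung (B)+1 — NOT infinite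
volume, NOT mass gap, NOT BetaPertH, NOT Clay.
-/

set_option autoImplicit false

open scoped BigOperators Matrix Matrix.Norms.L2Operator Topology
open NormedSpace Finset Set Filter Metric

namespace Summit.QuantumFields.BalabanUV.T4Continuum.NE7MinActHessianUniform

open Literature.MathematicalPhysics.QuantumFieldTheory.Balaban1983to89
open B7Prop1Explicit B7Prop2Explicit
open T4AveragingDeficitWall (IsUnitaryCfg SmallField fineAction)
open T4AveragingDeficitWallBoundary (IsPeriodicCfg)
open AveragingDeficitTorusChart (TDir chart chartDir)
open AveragingDeficitTwoLevelPrep (skewSub)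
open AveragingDeficitMultiLevelPrep (tower levelQ levelQ' tower_ne_zero)
open MinimalActionLevels (perWin stepWt)
open MinimalActionSandwich (IsMinimiser minAct)
open MinimalActionRate (sfClass)
open NE3EnergyShapes (IsUnitarySite IsPeriodicSite)
open NE3HessForm (hess)
open NE7MinActC2AllDataUniform (minAct_hessian_lagrangian_allData_uniform)
open NE7SecondVariationHess (second_variation)

noncomputable section

variable {n : Type} [Fintype n] [DecidableEq n]

/-- **THE BORDERED HESSIAN IN `hess` CURRENCY, AT EVERY SMALL DATUM, WITH A LEVEL-UNIFORM DATUM RADIUS** (see the module docstring). [folklore] -/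
theorem minAct_hessian_hessForm_allData_uniform [Nonempty n] {L : ℕ} [NeZero L] (hL : 2 ≤ L) :
    ∃ ε₀ : ℝ, 0 < ε₀ ∧ ∀ ε : ℝ, 0 < ε → ε ≤ ε₀ → ∀ (N : ℕ) [NeZero N], 1 ≤ N →
      ∃ δV : ℝ, 0 < δV ∧ ∀ j : ℕ,
        ∀ V₀ ∈ {V : Site 4 → Fin 4 → (Matrix n n ℂ)ˣ | IsUnitaryCfg V ∧ IsPeriodicCfg V (N : ℤ) ∧ SmallField V δV},
        (∃ Us : Site 4 → Fin 4 → (Matrix n n ℂ)ˣ, IsMinimiser 4 (sfClass 4 L N ε) L N (j + 1) V₀ Us) ∧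
        ∀ Us : Site 4 → Fin 4 → (Matrix n n ℂ)ˣ, IsMinimiser 4 (sfClass 4 L N ε) L N (j + 1) V₀ Us →
        ContDiffAt ℝ 2 (fun y : ↥(skewSub 4 n N) => minAct 4 (sfClass 4 L N ε) L N (j + 1) (chart (ContinuousLinearMap.id ℝ (Matrix n n ℂ)) N V₀ (y : TDir 4 n N))) 0 ∧
        ∀ v : ↥(skewSub 4 n N),
          IsLeast {q : ℝ | ∃ X : ↥(skewSub 4 n (L * tower L N j)), levelQ' L N j Us (X : TDir 4 n (L * tower L N j)) = v ∧
              q = ((stepWt 4 L)⁻¹) ^ (j + 1) * hess Us (chartDir (ContinuousLinearMap.id ℝ (Matrix n n ℂ)) (L * tower L N j) (X : TDir 4 n (L * tower L N j))) (chartDir (ContinuousLinearMap.id ℝ (Matrix n n ℂ)) (L * tower L N j) (X : TDir 4 n (L * tower L N j))) (perWin 4 (N * L ^ (j + 1)))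
                  - fderiv ℝ (fun y : ↥(skewSub 4 n N) => minAct 4 (sfClass 4 L N ε) L N (j + 1) (chart (ContinuousLinearMap.id ℝ (Matrix n n ℂ)) N V₀ (y : TDir 4 n N))) 0 (fderiv ℝ (fderiv ℝ (fun Φ : ↥(skewSub 4 n (L * tower L N j)) => levelQ L N j Us (chart (ContinuousLinearMap.id ℝ (Matrix n n ℂ)) (L * tower L N j) Us (Φ : TDir 4 n (L * tower L N j))))) 0 X X)}
            (fderiv ℝ (fderiv ℝ (fun y : ↥(skewSub 4 n N) => minAct 4 (sfClass 4 L N ε) L N (j + 1) (chart (ContinuousLinearMap.id ℝ (Matrix n n ℂ)) N V₀ (y : TDir 4 n N)))) 0 v v) := by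
  obtain ⟨ε₀, hε₀, H⟩ := minAct_hessian_lagrangian_allData_uniform (n := n) hL
  refine ⟨ε₀, hε₀, fun ε hε hεle N _ hN => ?_⟩
  obtain ⟨δV, hδV, hall⟩ := H ε hε hεle N hN
  refine ⟨δV, hδV, fun j V₀ hV₀ => ?_⟩
  obtain ⟨hex, hbord⟩ := hall j V₀ hV₀
  haveI : NeZero (L * tower L N j) := ⟨Nat.mul_ne_zero (NeZero.ne L) (tower_ne_zero L N j)⟩
  refine ⟨hex, fun Us hUs => ?_⟩
  obtain ⟨hC2, hleast⟩ := hbord Us hUs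
  refine ⟨hC2, fun v => ?_⟩
  have hset : {q : ℝ | ∃ X : ↥(skewSub 4 n (L * tower L N j)), levelQ' L N j Us (X : TDir 4 n (L * tower L N j)) = v ∧
      q = ((stepWt 4 L)⁻¹) ^ (j + 1) * hess Us (chartDir (ContinuousLinearMap.id ℝ (Matrix n n ℂ)) (L * tower L N j) (X : TDir 4 n (L * tower L N j))) (chartDir (ContinuousLinearMap.id ℝ (Matrix n n ℂ)) (L * tower L N j) (X : TDir 4 n (L * tower L N j))) (perWin 4 (N * L ^ (j + 1)))
          - fderiv ℝ (fun y : ↥(skewSub 4 n N) => minAct 4 (sfClass 4 L N ε) L N (j + 1) (chart (ContinuousLinearMap.id ℝ (Matrix n n ℂ)) N V₀ (y : TDir 4 n N))) 0 (fderiv ℝ (fderiv ℝ (fun Φ : ↥(skewSub 4 n (L * tower L N j)) => levelQ L N j Us (chart (ContinuousLinearMap.id ℝ (Matrix n n ℂ)) (L * tower L N j) Us (Φ : TDir 4 n (L * tower L N j))))) 0 X X)}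
      = {q : ℝ | ∃ X : ↥(skewSub 4 n (L * tower L N j)), levelQ' L N j Us (X : TDir 4 n (L * tower L N j)) = v ∧
          q = ((stepWt 4 L)⁻¹) ^ (j + 1) * fderiv ℝ (fderiv ℝ (fun Φ : ↥(skewSub 4 n (L * tower L N j)) => fineAction (chart (ContinuousLinearMap.id ℝ (Matrix n n ℂ)) (L * tower L N j) Us (Φ : TDir 4 n (L * tower L N j))) (perWin 4 (N * L ^ (j + 1))))) 0 X X
              - fderiv ℝ (fun y : ↥(skewSub 4 n N) => minAct 4 (sfClass 4 L N ε) L N (j + 1) (chart (ContinuousLinearMap.id ℝ (Matrix n n ℂ)) N V₀ (y : TDir 4 n N))) 0 (fderiv ℝ (fderiv ℝ (fun Φ : ↥(skewSub 4 n (L * tower L N j)) => levelQ L N j Us (chart (ContinuousLinearMap.id ℝ (Matrix n n ℂ)) (L * tower L N j) Us (Φ : TDir 4 n (L * tower L N j))))) 0 X X)} := by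
    ext q
    simp only [Set.mem_setOf_eq, second_variation]
  rw [hset]
  exact hleast v

end

end Summit.QuantumFields.BalabanUV.T4Continuum.NE7MinActHessianUniform
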